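import Literature.NumberTheory.GaloisRepresentations.ArtinLFunctionRegularReGeOneProofs
import Literature.NumberTheory.GaloisRepresentations.ArtinLFunctionContinuationFE
import Literature.NumberTheory.GaloisRepresentations.FramedRepDualIrreducible
import HarnessLib

/-!
# Artin L-functions are regular off the critical strip, given Artin's functional equation
(pure proofs; theorems only — no definition, no named fact)

**The printed statement** (A. R. Booker, *Poles of Artin L-functions and the strong Artin
conjecture*, Ann. of Math. 158 (2003), p. 1091, for the Dirichlet twists `ρ ⊗ χ` of an
irreducible `ρ : Gal(ℚ̄/ℚ) → GL₂(ℂ)`): "It is known, by nonvanishing results for Hecke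
L-functions [10], that `L(s, ρ ⊗ χ)` is holomorphic in `Re(s) ≥ 1`, and by the functional
equation, in `Re(s) ≤ 0`."  This is the analytic input of Booker's Lemma 1 (p. 1092: every
`L(s, ρ ⊗ χ₀)` "satisfies the conclusion of the lemma", i.e. is meromorphic on `ℂ` with poles only
in `0 < Re s < 1`), vendored in `Automorphic/BookerStrongArtin` as
`booker_additiveTwist_meromorphic`.

The half `Re s ≥ 1` is the tree's Heilbronn theorem
`exists_meromorphic_eq_artinLFunction_of_invariants_eq_bot` (`ArtinLFunctionRegularReGeOneProofs`).
This file adds the half `Re s ≤ 0` from Artin's functional equation — in the tree's predicate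
`ArtinRep.SatisfiesFunctionalEquation ρ ρ^∨` (the content of the named fact
`Automorphic.artin_functional_equation`, Neukirch VII (12.6), taken here as a HYPOTHESIS) — by the
classical reflection argument: `L(s, ρ) = W γ(ρ^∨, 1-s) L(1-s, ρ^∨) A'^{(1-s)/2} / (A^{s/2} γ(ρ, s))`
with `1/(A^{s/2} γ(ρ, s))` entire and the right side regular for `Re (1 - s) ≥ 1`.

* `LFunctions.exists_meromorphic_extension_of_functionalEquation` — **abstract gluing**
  (Mathlib only): if `E`, `E'` are meromorphic on `ℂ`, analytic at every point of `Re s ≥ 1`,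
  and continue `L`, `L'` from `Re s > 1`; `γ, γ'` are holomorphic on `Re s > 0`, `γinv` is entire
  with `γ γinv = 1` there; `Λ, Λ'` are meromorphic on `ℂ` with `Λ = γ L`, `Λ' = γ' L'` on
  `Re s > 1` and `Λ(1 - s) = W Λ'(s)`; then some `D`, meromorphic on `ℂ` and analytic at every
  `s` with `Re s ≤ 0` or `Re s ≥ 1`, agrees with `L` on `Re s > 1`.  (Same bookkeeping as the
  tree's `LFunctions.exists_entire_extension_of_functionalEquation`, which treats the case where
  the two continuations overlap and yields an entire function; here they do not overlap and the
  identity principle for Mathlib-meromorphic functions only gives agreement on punctured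
  neighbourhoods, which is exactly what gluing a MEROMORPHIC function along `Re s = 1/2` needs.)
* `ArtinRep.exists_meromorphic_offStrip_of_satisfiesFunctionalEquation` — for Artin
  representations `ρ`, `ρ'` of a number field `K : Type` with `V^{Γ_K} = 0`, `V'^{Γ_K} = 0`
  satisfying `ρ.SatisfiesFunctionalEquation ρ'`: `L(s, ρ)` agrees on `Re s > 1` with a function
  meromorphic on `ℂ` and analytic at every `s` with `Re s ≤ 0` or `Re s ≥ 1`.
* `FramedArtinRep.exists_meromorphic_offStrip_of_isIrreducible` — the case of an irreducible
  `ρ : Γ_K → GL_n(ℂ)`, `n ≥ 2`, with the functional equation against `ρ^∨` (Booker's twists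
  `ρ ⊗ χ₀`): `ρ^∨` is irreducible (`FramedRep.isIrreducible_toContinuousRep_dual`), so neither has
  invariants.

## References

* A. R. Booker, Ann. of Math. 158 (2003), p. 1091 and Lemma 1 p. 1092. [Booker2003]
* J. Neukirch, *Algebraic Number Theory* (1999), VII §12, Thm. (12.6). [NeukirchANT1999]
* H. Heilbronn, in Cassels–Fröhlich, *Algebraic Number Theory* (1967), Ch. VIII §3, after Thm. 7
  (the functional equation of Artin L-functions; regularity on `σ ≥ 1`). [HeilbronnZetaL1967]

## Mathlib / tree search

Mathlib: `MeromorphicAt.congr`, `AnalyticAt.congr`, `MeromorphicAt.comp_analyticAt`,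
`MeromorphicOn.meromorphicOrderAt_ne_top_of_isPreconnected` (through the tree's
`LFunctions.eventuallyEq_zero_of_eqOn_halfPlane`, `LFunctions.tendsto_one_sub_nhdsNE`).  Tree:
`exists_meromorphic_eq_artinLFunction_of_invariants_eq_bot`,
`ArtinRep.exists_differentiable_mul_completedFactor_eq_one`, `ArtinRep.differentiableOn_gammaFactor`,
`FramedRep.isIrreducible_toContinuousRep_dual`; `lean search 'offStrip|re_le_zero.*AnalyticAt'`:
nothing of this shape before this file.
-/

noncomputable section

open Set Filter Topology

/-! ### Abstract gluing along `Re s = 1/2` -/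

namespace Literature.NumberTheory.LFunctions

/-- **Meromorphic continuation regular off the critical strip, from a functional equation.**
Suppose
* `E`, `E'` are meromorphic at every point of `ℂ`, ANALYTIC at every `s` with `1 ≤ Re s`, and
  agree with `L`, `L'` on `Re s > 1`;
* `γ`, `γ'` are holomorphic on `Re s > 0`, and `γinv` is entire with `γ · γinv = 1` on `Re s > 0`;
* `Λ`, `Λ'` are meromorphic at every point, `Λ = γ L` and `Λ' = γ' L'` on `Re s > 1`, and
  `Λ(1 - s) = W Λ'(s)` for all `s`.
Then some `D : ℂ → ℂ`, meromorphic at every point and analytic at every `s` with `Re s ≤ 0` or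
`1 ≤ Re s`, agrees with `L` on `Re s > 1`.  Proof: near every point of `Re s > 0`, `Λ = γ E` and
`Λ' = γ' E'` on punctured neighbourhoods (identity principle,
`eventuallyEq_zero_of_eqOn_halfPlane`); so on the strip `0 < Re s < 1`, puncturedly,
`E = h₂ := W γ'(1 - ·) E'(1 - ·) γinv`; glue `D = E` on `Re s > 1/2`, `D = h₂` on `Re s ≤ 1/2`
(meromorphic at the seam because the two pieces agree on punctured neighbourhoods there), and
`h₂` is analytic wherever `Re (1 - s) ≥ 1`. [folklore] -/
theorem exists_meromorphic_extension_of_functionalEquation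
    {L L' Λ Λ' γ γ' γinv E E' : ℂ → ℂ} {W : ℂ}
    (hEm : ∀ z : ℂ, MeromorphicAt E z) (hEa : ∀ s : ℂ, 1 ≤ s.re → AnalyticAt ℂ E s)
    (hEL : ∀ s : ℂ, 1 < s.re → E s = L s)
    (hE'm : ∀ z : ℂ, MeromorphicAt E' z) (hE'a : ∀ s : ℂ, 1 ≤ s.re → AnalyticAt ℂ E' s)
    (hE'L' : ∀ s : ℂ, 1 < s.re → E' s = L' s)
    (hγ : DifferentiableOn ℂ γ {s : ℂ | 0 < s.re}) (hγ' : DifferentiableOn ℂ γ' {s : ℂ | 0 < s.re})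
    (hγinv : Differentiable ℂ γinv) (hγγ : ∀ s : ℂ, 0 < s.re → γ s * γinv s = 1)
    (hΛ : ∀ z : ℂ, MeromorphicAt Λ z) (hΛ' : ∀ z : ℂ, MeromorphicAt Λ' z)
    (hΛL : ∀ s : ℂ, 1 < s.re → Λ s = γ s * L s) (hΛ'L' : ∀ s : ℂ, 1 < s.re → Λ' s = γ' s * L' s)
    (hFE : ∀ s : ℂ, Λ (1 - s) = W * Λ' s) :
    ∃ D : ℂ → ℂ, (∀ z : ℂ, MeromorphicAt D z) ∧
      (∀ s : ℂ, s.re ≤ 0 ∨ 1 ≤ s.re → AnalyticAt ℂ D s) ∧ ∀ s : ℂ, 1 < s.re → D s = L s := by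
  classical
  set U : Set ℂ := {s : ℂ | 0 < s.re} with hU
  have hUo : IsOpen U := isOpen_lt continuous_const Complex.continuous_re
  have hγan : ∀ x ∈ U, AnalyticAt ℂ γ x := fun x hx => hγ.analyticAt (hUo.mem_nhds hx)
  have hγ'an : ∀ x ∈ U, AnalyticAt ℂ γ' x := fun x hx => hγ'.analyticAt (hUo.mem_nhds hx)
  -- Step A: `Λ = γ E` puncturedly near every point of `U`
  have hA : ∀ x ∈ U, ∀ᶠ z in 𝓝[≠] x, Λ z = γ z * E z := by
    intro x hx
    have hN : MeromorphicOn (fun s => Λ s - γ s * E s) U := fun s hs =>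
      (hΛ s).sub ((hγan s hs).meromorphicAt.mul (hEm s))
    have h0 : ∀ s : ℂ, 1 < s.re → Λ s - γ s * E s = 0 := fun s hs => by
      rw [hΛL s hs, hEL s hs, sub_self]
    filter_upwards [eventuallyEq_zero_of_eqOn_halfPlane hN h0 hx] with z hz
    exact sub_eq_zero.1 hz
  -- Step B: `Λ' = γ' E'` puncturedly near every point of `U`
  have hB : ∀ x ∈ U, ∀ᶠ z in 𝓝[≠] x, Λ' z = γ' z * E' z := by
    intro x hx
    have hN : MeromorphicOn (fun s => Λ' s - γ' s * E' s) U := fun s hs =>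
      (hΛ' s).sub ((hγ'an s hs).meromorphicAt.mul (hE'm s))
    have h0 : ∀ s : ℂ, 1 < s.re → Λ' s - γ' s * E' s = 0 := fun s hs => by
      rw [hΛ'L' s hs, hE'L' s hs, sub_self]
    filter_upwards [eventuallyEq_zero_of_eqOn_halfPlane hN h0 hx] with z hz
    exact sub_eq_zero.1 hz
  -- Step C: the reflected candidate
  set h₂ : ℂ → ℂ := fun s => W * (γ' (1 - s) * E' (1 - s)) * γinv s with hh₂
  have hrefl : ∀ s : ℂ, AnalyticAt ℂ (fun s : ℂ => 1 - s) s := fun s =>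
    analyticAt_const.sub analyticAt_id
  have hre1 : ∀ s : ℂ, (1 - s).re = 1 - s.re := fun s => by
    rw [Complex.sub_re, Complex.one_re]
  -- `h₂` is meromorphic at every point of `Re s < 1` and analytic at every point of `Re s ≤ 0`
  have hh₂m : ∀ s : ℂ, s.re < 1 → MeromorphicAt h₂ s := by
    intro s hs
    have h1s : (1 - s) ∈ U := by show 0 < (1 - s).re; rw [hre1]; linarith
    have hγ's : AnalyticAt ℂ (fun z => γ' (1 - z)) s := (hγ'an _ h1s).comp (hrefl s)
    have hE's : MeromorphicAt (fun z => E' (1 - z)) s := (hE'm (1 - s)).comp_analyticAt (hrefl s)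
    exact (((MeromorphicAt.const W s).mul (hγ's.meromorphicAt.mul hE's)).mul
      (hγinv.analyticAt s).meromorphicAt)
  have hh₂a : ∀ s : ℂ, s.re ≤ 0 → AnalyticAt ℂ h₂ s := by
    intro s hs
    have h1s : (1 - s) ∈ U := by show 0 < (1 - s).re; rw [hre1]; linarith
    have hγ's : AnalyticAt ℂ (fun z => γ' (1 - z)) s := (hγ'an _ h1s).comp (hrefl s)
    have hE's : AnalyticAt ℂ (fun z => E' (1 - z)) s :=
      (hE'a (1 - s) (by rw [hre1]; linarith)).comp (hrefl s)
    exact ((analyticAt_const.mul (hγ's.mul hE's)).mul (hγinv.analyticAt s))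
  -- Step D: on the open strip, `E = h₂` puncturedly
  have hD : ∀ x : ℂ, 0 < x.re → x.re < 1 → ∀ᶠ z in 𝓝[≠] x, E z = h₂ z := by
    intro x hxU hxV
    have h1x : (1 - x) ∈ U := by show 0 < (1 - x).re; rw [hre1]; linarith
    have hBx : ∀ᶠ z in 𝓝[≠] x, Λ' (1 - z) = γ' (1 - z) * E' (1 - z) :=
      (tendsto_one_sub_nhdsNE x).eventually (hB (1 - x) h1x)
    have hUx : ∀ᶠ z in 𝓝[≠] x, z ∈ U :=
      eventually_nhdsWithin_of_eventually_nhds (hUo.mem_nhds hxU)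
    filter_upwards [hA x hxU, hBx, hUx] with z hz hz' hzU
    have hfe : Λ z = W * Λ' (1 - z) := by
      have := hFE (1 - z)
      rwa [sub_sub_cancel] at this
    calc E z = γ z * γinv z * E z := by rw [hγγ z hzU, one_mul]
      _ = γinv z * (γ z * E z) := by ring
      _ = γinv z * (W * (γ' (1 - z) * E' (1 - z))) := by rw [← hz, hfe, hz']
      _ = h₂ z := by rw [hh₂]; ring
  -- Step E: glue along `Re s = 1/2`
  refine ⟨fun s => if 1 / 2 < s.re then E s else h₂ s, fun z => ?_, fun s hs => ?_,
    fun s hs => ?_⟩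
  rotate_left 2
  · show (if 1 / 2 < s.re then E s else h₂ s) = L s
    rw [if_pos (show (1 : ℝ) / 2 < s.re by linarith), hEL s hs]
  · -- meromorphic everywhere
    rcases lt_trichotomy (z.re) (1 / 2) with hz | hz | hz
    · have hev : (fun s => if 1 / 2 < s.re then E s else h₂ s) =ᶠ[𝓝 z] h₂ := by
        filter_upwards [(isOpen_lt Complex.continuous_re continuous_const).mem_nhds hz] with w hw
        exact if_neg (not_lt.mpr (le_of_lt hw))
      exact (hh₂m z (by linarith)).congr (hev.filter_mono nhdsWithin_le_nhds).symm
    · have hev : (fun s => if 1 / 2 < s.re then E s else h₂ s) =ᶠ[𝓝[≠] z] E := by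
        filter_upwards [hD z (by linarith) (by linarith)] with w hw
        by_cases hwr : 1 / 2 < w.re
        · exact if_pos hwr
        · rw [if_neg hwr]; exact hw.symm
      exact (hEm z).congr hev.symm
    · have hev : (fun s => if 1 / 2 < s.re then E s else h₂ s) =ᶠ[𝓝 z] E := by
        filter_upwards [(isOpen_lt continuous_const Complex.continuous_re).mem_nhds hz] with w hw
        exact if_pos hw
      exact (hEm z).congr (hev.filter_mono nhdsWithin_le_nhds).symm
  · -- analytic off the strip
    rcases hs with hs | hs
    · have hev : (fun s => if 1 / 2 < s.re then E s else h₂ s) =ᶠ[𝓝 s] h₂ := by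
        filter_upwards [(isOpen_lt Complex.continuous_re continuous_const).mem_nhds
          (show s.re < 1 / 2 by linarith)] with w hw
        exact if_neg (not_lt.mpr (le_of_lt hw))
      exact (hh₂a s hs).congr hev.symm
    · have hev : (fun s => if 1 / 2 < s.re then E s else h₂ s) =ᶠ[𝓝 s] E := by
        filter_upwards [(isOpen_lt continuous_const Complex.continuous_re).mem_nhds
          (show (1 : ℝ) / 2 < s.re by linarith)] with w hw
        exact if_pos hw
      exact (hEa s hs).congr hev.symm

end Literature.NumberTheory.LFunctions

/-! ### Artin L-functions -/

namespace Literature.NumberTheory.GaloisRepresentations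

universe w w'

namespace ArtinRep

variable {K : Type} [Field K] [NumberField K] {V : Type w} [AddCommGroup V] [Module ℂ V]
  [TopologicalSpace V] [FiniteDimensional ℂ V] {V' : Type w'} [AddCommGroup V'] [Module ℂ V']
  [TopologicalSpace V'] [FiniteDimensional ℂ V']

/-- **Artin L-functions without trivial constituent are regular off the critical strip, given
the functional equation** (Booker 2003, p. 1091: "`L(s, ρ ⊗ χ)` is holomorphic in `Re(s) ≥ 1`,
and by the functional equation, in `Re(s) ≤ 0`").  Let `ρ`, `ρ'` be Artin representations of the
number field `K` with `V^{Γ_K} = 0`, `V'^{Γ_K} = 0` satisfying Artin's functional equation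
(`ρ.SatisfiesFunctionalEquation ρ'`: meromorphic `Λ, Λ'` continuing `Λ(s, ρ) = A^{s/2} γ(ρ, s) L(s, ρ)`
and `Λ(s, ρ')`, with `Λ(1 - s) = W Λ'(s)`; Neukirch VII (12.6) with `ρ' = ρ^∨`).  Then there is
`D : ℂ → ℂ`, meromorphic at every point, analytic at every `s` with `Re s ≤ 0` or `1 ≤ Re s`, and
equal to `L(s, ρ)` on `Re s > 1`.  Inputs: Heilbronn's regularity on `Re s ≥ 1` for `ρ` and `ρ'`
(`exists_meromorphic_eq_artinLFunction_of_invariants_eq_bot`), the holomorphy of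
`A^{s/2} γ(ρ, s)` on `Re s > 0` and its entire inverse
(`exists_differentiable_mul_completedFactor_eq_one`), and the abstract gluing
`LFunctions.exists_meromorphic_extension_of_functionalEquation`.
[cite: Booker2003, p. 1091] [cite: NeukirchANT1999, VII §12, Thm. (12.6)] -/
theorem exists_meromorphic_offStrip_of_satisfiesFunctionalEquation [IsModuleTopology ℂ V]
    [IsModuleTopology ℂ V'] {ρ : ArtinRep K V} {ρ' : ArtinRep K V'}
    (hFE : ρ.SatisfiesFunctionalEquation ρ') (hρ : ρ.invariants = ⊥) (hρ' : ρ'.invariants = ⊥) :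
    ∃ D : ℂ → ℂ, (∀ z : ℂ, MeromorphicAt D z) ∧
      (∀ s : ℂ, s.re ≤ 0 ∨ 1 ≤ s.re → AnalyticAt ℂ D s) ∧
      ∀ s : ℂ, 1 < s.re → D s = artinLFunction ρ s := by
  obtain ⟨E, hEm, hEa, hEL⟩ := exists_meromorphic_eq_artinLFunction_of_invariants_eq_bot ρ hρ
  obtain ⟨E', hE'm, hE'a, hE'L'⟩ := exists_meromorphic_eq_artinLFunction_of_invariants_eq_bot ρ' hρ'
  obtain ⟨Λ, Λ', hΛ, hΛ', hagree, W, -, hW⟩ := hFE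
  obtain ⟨hγ, γinv, hγinv, hγγ⟩ := ρ.exists_differentiable_mul_completedFactor_eq_one
  have hγ' := (ρ'.exists_differentiable_mul_completedFactor_eq_one).1
  exact Literature.NumberTheory.LFunctions.exists_meromorphic_extension_of_functionalEquation
    hEm (fun s hs => (hEa s hs).1) hEL hE'm (fun s hs => (hE'a s hs).1) hE'L' hγ hγ' hγinv hγγ
    hΛ hΛ' (fun s hs => by rw [(hagree s hs).1, completedArtinLFunction])
    (fun s hs => by rw [(hagree s hs).2, completedArtinLFunction]) hW

end ArtinRep

/-! ### Irreducible framed representations of rank `≥ 2` -/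

section Framed

/-- An irreducible representation of dimension at least `2` has no non-zero invariant vector
(private copy of `Automorphic.invariants_eq_bot_of_isIrreducible_of_one_lt_finrank`, whose file
`Automorphic/BookerStrongArtinReduction` is not imported here to keep this cone light: the
invariants form a subrepresentation, hence are `0` or everything, and in the latter case every
line is a subrepresentation). [cite: SerreLinearRepresentations1977, §2.3] -/
private theorem invariants_eq_bot_of_isIrreducible_of_one_lt_finrank'
    {k G M : Type*} [Field k] [Group G] [AddCommGroup M] [Module k M]
    (τ : Representation k G M) (hirr : τ.IsIrreducible) (hM : 1 < Module.finrank k M) :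
    τ.invariants = ⊥ := by
  let I : Subrepresentation τ := ⟨τ.invariants, fun g v hv => by
    rw [Representation.mem_invariants] at hv ⊢
    intro h
    rw [hv g, hv h]⟩
  haveI := hirr
  rcases IsSimpleOrder.eq_bot_or_eq_top I with h | h
  · exact congrArg Subrepresentation.toSubmodule h
  · exfalso
    have hall : ∀ (g : G) (v : M), τ g v = v := fun g v => by
      have hv : v ∈ I.toSubmodule := by rw [h]; trivial
      exact (Representation.mem_invariants τ v).mp hv g
    -- every submodule is a subrepresentation; pick a line
    have hpos : 0 < Module.finrank k M := by omega
    haveI : FiniteDimensional k M := Module.finite_of_finrank_pos hpos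
    obtain ⟨v, hv⟩ := Module.finrank_pos_iff_exists_ne_zero.mp hpos
    let Lsub : Subrepresentation τ := ⟨k ∙ v, fun g w hw => by rw [hall g w]; exact hw⟩
    rcases IsSimpleOrder.eq_bot_or_eq_top Lsub with hL | hL
    · have : v ∈ (Lsub : Subrepresentation τ).toSubmodule := Submodule.mem_span_singleton_self v
      rw [hL] at this
      exact hv ((Submodule.mem_bot k).mp this)
    · have hrank : Module.finrank k (k ∙ v) = Module.finrank k M := by
        have := congrArg Subrepresentation.toSubmodule hL
        change (k ∙ v) = (⊤ : Subrepresentation τ).toSubmodule at this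
        rw [this]
        exact finrank_top k M
      rw [finrank_span_singleton hv] at hrank
      omega

variable {K : Type} [Field K] [NumberField K] {n : ℕ}

/-- **For an irreducible `ρ : Γ_K → GL_n(ℂ)`, `n ≥ 2`, satisfying Artin's functional equation
against `ρ^∨`, `L(s, ρ)` is regular off the critical strip** (the representations `ρ ⊗ χ₀` of
Booker 2003, p. 1091 and proof of Lemma 1): some `D`, meromorphic at every point of `ℂ` and
analytic at every `s` with `Re s ≤ 0` or `1 ≤ Re s`, agrees with `L(s, ρ)` on `Re s > 1`.  The
dual of an irreducible framed representation is irreducible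
(`FramedRep.isIrreducible_toContinuousRep_dual`), and irreducible representations of dimension
`≥ 2` have no invariants, so `exists_meromorphic_offStrip_of_satisfiesFunctionalEquation` applies.
The hypothesis `hFE` is the instance at `ρ` of the named fact `Automorphic.artin_functional_equation`.
[cite: Booker2003, p. 1091] [cite: NeukirchANT1999, VII §12, Thm. (12.6)] -/
theorem FramedArtinRep.exists_meromorphic_offStrip_of_isIrreducible (ρ : FramedArtinRep K n)
    (hirr : ρ.toGaloisRep.IsIrreducible) (hn : 1 < n)
    (hFE : ArtinRep.SatisfiesFunctionalEquation ρ.toArtinRep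
      (FramedArtinRep.toArtinRep (FramedRep.dual ρ))) :
    ∃ D : ℂ → ℂ, (∀ z : ℂ, MeromorphicAt D z) ∧
      (∀ s : ℂ, s.re ≤ 0 ∨ 1 ≤ s.re → AnalyticAt ℂ D s) ∧
      ∀ s : ℂ, 1 < s.re → D s = artinLFunction ρ.toArtinRep s := by
  have hρ : (ρ.toArtinRep).invariants = ⊥ :=
    invariants_eq_bot_of_isIrreducible_of_one_lt_finrank' _ hirr (by simpa using hn)
  have hρ' : (FramedArtinRep.toArtinRep (FramedRep.dual ρ)).invariants = ⊥ :=
    invariants_eq_bot_of_isIrreducible_of_one_lt_finrank' _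
      (FramedRep.isIrreducible_toContinuousRep_dual ρ hirr) (by simpa using hn)
  exact ArtinRep.exists_meromorphic_offStrip_of_satisfiesFunctionalEquation hFE hρ hρ'

end Framed

end Literature.NumberTheory.GaloisRepresentations

end
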